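import Literature.NumberTheory.EllipticCurves.IwasawaLocalKummerSkeletonProofs
import Literature.NumberTheory.EllipticCurves.IwasawaSelmerControlLocalInputsProofs
import HarnessLib

/-!
# The Kummer-theoretic skeleton with a stable subgroup, and the layer-`0` local tower kernel

Sibling proof file (theorems only: **no definition and no named fact is introduced**) of
`Literature.NumberTheory.EllipticCurves.IwasawaSelmerControl` /
`Literature.NumberTheory.EllipticCurves.SelmerCorankControl`, continuing
`IwasawaLocalKummerSkeletonProofs` (R. Greenberg, *Iwasawa theory for elliptic curves*, LNM 1716
(1999), §3, Lemma 3.4, p. 89 of the held copy `book:coates1999-arithmetic-theory-elliptic-curves`).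
Two pieces of pure topological-group bookkeeping used by the assembly of Lemma 3.4 at the layer
`n = 0` for `E/ℚ` with good ordinary reduction at `p`:

* `ResKernel.finite_primary_subgroupResKer_of_stableSubgroup` — the skeleton
  `ResKernel.finite_primary_subgroupResKer_of_reduction` restated with the reduction map replaced
  by its kernel: a `G`-stable subgroup `A₁ ≤ A` ("`E₁(K̄_v)`", the kernel of reduction) such that
  `A/A₁` is torsion, `A₁` is `p`-divisible, the classes of `A/A₁` fixed by `N` have finitely many
  representatives, with the cocycle count (C1) and the Kummer point (C2) phrased through
  membership in `A₁`. The quotient `Ā = A/A₁` with its induced discrete `G`-action is built inside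
  the proof (so that no `Γ_{K_v}`-module structure on `Ẽ(k̄_v)` is needed downstream).
* `WeierstrassCurve.finite_localTowerKerPrimary_zero_of_finite_primary_subgroupResKer` — at the
  layer `n = 0` the local subgroup `H_{E,0} = (Γ_E → Γ_K)⁻¹(Gal(K̄/K_0))` is all of `Γ_E`, so the
  `p`-power torsion of the local tower kernel
  `𝒦_{E,0} = ker (H¹(H_{E,0}, E(K̄_E)) → H¹(H_{E,∞}, E(K̄_E)))` (`localTowerKerPrimary`) embeds
  into the `p`-power torsion of the restriction kernel `ker (H¹(Γ_E, E(K̄_E)) → H¹(H_{E,∞}, E(K̄_E)))`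
  (`subgroupResKer`), along the bijection `H¹(Γ_E, ·) ≃ H¹(H_{E,0}, ·)`
  (`bijective_resH1Hom_subgroupIncl`).

## References

* [GreenbergLNM1716] R. Greenberg, *Iwasawa theory for elliptic curves*, LNM 1716 (1999), §3,
  Lemma 3.4 (p. 89) and p. 86 (the maps `r_{v_n}`).
* J.-P. Serre, *Galois Cohomology* (1997), I.§2.4–2.6, II.§1.
-/

noncomputable section

open scoped Classical

universe u

namespace Literature.NumberTheory.EllipticCurves.ResKernel

open Literature.NumberTheory.GaloisRepresentations

variable {G : Type u} [Group G] [TopologicalSpace G] [IsTopologicalGroup G]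
variable {A : Type u} [AddCommGroup A] [DistribMulAction G A] [TopologicalSpace A]
  [DiscreteTopology A]

set_option maxHeartbeats 800000 in
/-- **The `p`-power torsion of `ker (H¹(G, A) → H¹(N, A))` is finite — the skeleton
`finite_primary_subgroupResKer_of_reduction` with a `G`-stable subgroup `A₁ ≤ A` in place of the
reduction map.** Hypotheses (`N ⊴ G`, `γ` and `N` generating `G` topologically, `A` a discrete
`G`-module): (div) `A` is `p`-divisible; (div₁) `A₁` is `p`-divisible; (tor) every `a ∈ A` has a
positive multiple in `A₁`; (fin) the elements `a` with `n a - a ∈ A₁` for all `n ∈ N` are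
congruent modulo `A₁` to finitely many of them; (C1) for every `k` the continuous cocycles with
values in `A₁ ∩ A[p^k]` fall into `≤ c₀ p^k` classes modulo coboundaries of `p^k`-torsion
elements; (C2) a `G`-fixed `u₁ ∈ A₁` with `n u₁ ∈ p^m A^G ⇒ p^m ∣ c₁ n`. Proof: the quotient
`Ā = A/A₁` with the induced action `g • ā = \overline{g a}` is a discrete `G`-module (orbit maps
factor through those of `A`), the quotient map is an equivariant surjection with kernel `A₁`,
`Ā` is torsion by (tor) and `Ā^N` is finite by (fin); apply
`finite_primary_subgroupResKer_of_reduction`. Greenberg, LNM 1716, §3, proof of Lemma 3.4 (p. 89,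
diagram (5)) in `E(K̄_v)`-coefficients. [cite: GreenbergLNM1716, §3 Lemma 3.4 (p. 89)] -/
theorem finite_primary_subgroupResKer_of_stableSubgroup (N : Subgroup G) [N.Normal] (γ : G)
    (hgen : ∀ U : Subgroup G, IsOpen (U : Set G) → N ≤ U → γ ∈ U → U = ⊤)
    (hcont : ∀ a : A, Continuous fun g : G ↦ g • a) (p : ℕ) [hp : Fact p.Prime]
    (A₁ : AddSubgroup A) (hA₁ : ∀ (g : G) (a : A), a ∈ A₁ → g • a ∈ A₁)
    (hdiv : ∀ a : A, ∃ b : A, p • b = a)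
    (hdiv₁ : ∀ a ∈ A₁, ∃ b ∈ A₁, p • b = a)
    (htor : ∀ a : A, ∃ n : ℕ, 0 < n ∧ n • a ∈ A₁)
    (hfin : ∃ F : Finset A, ∀ a : A, (∀ n ∈ N, n • a - a ∈ A₁) → ∃ f ∈ F, a - f ∈ A₁)
    {c₀ : ℕ} (hC1 : ∀ k : ℕ, ∃ S : Finset (contOneCocycles (discreteTopRep G A)),
      S.card ≤ c₀ * p ^ k ∧ ∀ ψ : contOneCocycles (discreteTopRep G A),
        (∀ g, p ^ k • ψ.1 g = 0) → (∀ g, ψ.1 g ∈ A₁) →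
          ∃ ψ₀ ∈ S, ∃ t : A, p ^ k • t = 0 ∧ ∀ g, ψ.1 g - ψ₀.1 g = g • t - t)
    {u₁ : A} (hu₁G : ∀ g : G, g • u₁ = u₁) (hu₁ : u₁ ∈ A₁) {c₁ : ℕ} (hc₁ : 0 < c₁)
    (hC2 : ∀ (m : ℕ) (n : ℤ) (a : A), (∀ g : G, g • a = a) → n • u₁ = p ^ m • a →
      ((p ^ m : ℕ) : ℤ) ∣ c₁ * n) :
    Finite {x : subgroupResKer A N // ∃ k : ℕ, p ^ k • x = 0} := by
  -- the quotient `Ā = A / A₁` with its induced `G`-action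
  have hle : ∀ g : G, A₁ ≤ A₁.comap (DistribSMul.toAddMonoidHom A g) :=
    fun g a ha ↦ hA₁ g a ha
  letI iDMA : DistribMulAction G (A ⧸ A₁) :=
    { smul := fun g ↦ QuotientAddGroup.map A₁ A₁ (DistribSMul.toAddMonoidHom A g) (hle g)
      one_smul := fun x ↦ QuotientAddGroup.induction_on x fun a ↦ by
        change QuotientAddGroup.map A₁ A₁ (DistribSMul.toAddMonoidHom A 1) (hle 1)
          (QuotientAddGroup.mk a) = QuotientAddGroup.mk a
        rw [QuotientAddGroup.map_mk, DistribSMul.toAddMonoidHom_apply, one_smul]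
      mul_smul := fun g h x ↦ QuotientAddGroup.induction_on x fun a ↦ by
        change QuotientAddGroup.map A₁ A₁ (DistribSMul.toAddMonoidHom A (g * h)) (hle (g * h))
            (QuotientAddGroup.mk a) =
          QuotientAddGroup.map A₁ A₁ (DistribSMul.toAddMonoidHom A g) (hle g)
            (QuotientAddGroup.map A₁ A₁ (DistribSMul.toAddMonoidHom A h) (hle h)
              (QuotientAddGroup.mk a))
        rw [QuotientAddGroup.map_mk, QuotientAddGroup.map_mk, QuotientAddGroup.map_mk,
          DistribSMul.toAddMonoidHom_apply, DistribSMul.toAddMonoidHom_apply,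
          DistribSMul.toAddMonoidHom_apply, mul_smul]
      smul_zero := fun g ↦
        map_zero (QuotientAddGroup.map A₁ A₁ (DistribSMul.toAddMonoidHom A g) (hle g))
      smul_add := fun g ↦
        map_add (QuotientAddGroup.map A₁ A₁ (DistribSMul.toAddMonoidHom A g) (hle g)) }
  letI : TopologicalSpace (A ⧸ A₁) := ⊥
  haveI : DiscreteTopology (A ⧸ A₁) := ⟨rfl⟩
  set red : A →+ A ⧸ A₁ := QuotientAddGroup.mk' A₁ with hred_def
  have hsmul_mk : ∀ (g : G) (a : A), g • red a = red (g • a) := fun g a ↦ by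
    change QuotientAddGroup.map A₁ A₁ (DistribSMul.toAddMonoidHom A g) (hle g)
      (QuotientAddGroup.mk a) = QuotientAddGroup.mk (g • a)
    rw [QuotientAddGroup.map_mk, DistribSMul.toAddMonoidHom_apply]
  have hred : ∀ (g : G) (a : A), red (g • a) = g • red a := fun g a ↦ (hsmul_mk g a).symm
  have hred0 : ∀ a : A, red a = 0 ↔ a ∈ A₁ := fun a ↦ QuotientAddGroup.eq_zero_iff a
  have hsurj : Function.Surjective red := QuotientAddGroup.mk'_surjective A₁
  -- `Ā` is a discrete `G`-module
  have hcontĀ : ∀ ā : A ⧸ A₁, Continuous fun g : G ↦ g • ā := by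
    intro ā
    obtain ⟨a, rfl⟩ := hsurj ā
    have e : (fun g : G ↦ g • red a) = red ∘ fun g : G ↦ g • a := by
      ext g; exact hsmul_mk g a
    rw [e]
    exact continuous_of_discreteTopology.comp (hcont a)
  -- (div₁), (tor) in quotient form
  have hdiv₁' : ∀ a : A, red a = 0 → ∃ b : A, red b = 0 ∧ p • b = a := by
    intro a ha
    obtain ⟨b, hb, hpb⟩ := hdiv₁ a ((hred0 a).mp ha)
    exact ⟨b, (hred0 b).mpr hb, hpb⟩
  have htor' : ∀ ā : A ⧸ A₁, IsOfFinAddOrder ā := by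
    intro ā
    obtain ⟨a, rfl⟩ := hsurj ā
    obtain ⟨n, hn, hna⟩ := htor a
    exact isOfFinAddOrder_iff_nsmul_eq_zero.mpr ⟨n, hn, by rw [← map_nsmul]; exact (hred0 _).mpr hna⟩
  -- (fin): `Ā^N` is finite
  haveI : Finite (FixedPoints.addSubgroup N (A ⧸ A₁)) := by
    obtain ⟨F, hF⟩ := hfin
    have hsub : ((FixedPoints.addSubgroup N (A ⧸ A₁) : AddSubgroup (A ⧸ A₁)) : Set (A ⧸ A₁)) ⊆
        ↑(F.image red) := by
      intro x hx
      obtain ⟨a, rfl⟩ := hsurj x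
      have ha : ∀ n ∈ N, n • a - a ∈ A₁ := fun n hn ↦ by
        rw [← hred0, map_sub, hred, sub_eq_zero]
        exact hx ⟨n, hn⟩
      obtain ⟨f, hf, haf⟩ := hF a ha
      rw [Finset.coe_image]
      refine ⟨f, hf, ?_⟩
      rw [eq_comm, ← sub_eq_zero, ← map_sub, hred0]
      exact haf
    exact Set.Finite.to_subtype ((F.image red).finite_toSet.subset hsub)
  -- (C1) in quotient form
  have hC1' : ∀ k : ℕ, ∃ S : Finset (contOneCocycles (discreteTopRep G A)),
      S.card ≤ c₀ * p ^ k ∧ ∀ ψ : contOneCocycles (discreteTopRep G A),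
        (∀ g, p ^ k • ψ.1 g = 0) → (∀ g, red (ψ.1 g) = 0) →
          ∃ ψ₀ ∈ S, ∃ t : A, p ^ k • t = 0 ∧ ∀ g, ψ.1 g - ψ₀.1 g = g • t - t := by
    intro k
    obtain ⟨S, hS, hrep⟩ := hC1 k
    exact ⟨S, hS, fun ψ hψ hψr ↦ hrep ψ hψ fun g ↦ (hred0 _).mp (hψr g)⟩
  exact finite_primary_subgroupResKer_of_reduction N γ hgen hcont hcontĀ red hred hsurj p hdiv
    hdiv₁' htor' hC1' hu₁G ((hred0 u₁).mpr hu₁) hc₁ hC2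

end Literature.NumberTheory.EllipticCurves.ResKernel

/-! ## The layer `n = 0`: `𝒦_{E,0}[p^∞]` embeds into the `p`-power torsion of `ker res` on `Γ_E` -/

namespace WeierstrassCurve

open Literature.NumberTheory.EllipticCurves Literature.NumberTheory.EllipticCurves.ResKernel

variable {K : Type u} [Field K] (W : WeierstrassCurve K) {p : ℕ} [Fact p.Prime]
  (κ : ZpExtension K p) (E : Type u) [Field E] [Algebra K E]

/-- **At the layer `n = 0` the `p`-power torsion of the local tower kernel embeds into that of
the restriction kernel on the whole local Galois group.** With `H_{E,0} = (Γ_E → Γ_K)⁻¹(Gal(K̄/K_0))`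
(every element of `Γ_E`, `K_0 = K`) and `H_{E,∞} = (Γ_E → Γ_K)⁻¹(Gal(K̄/K_∞))`: if the `p`-power
torsion of `ker (H¹(Γ_E, E(K̄_E)) → H¹(H_{E,∞}, E(K̄_E)))` (`subgroupResKer`) is finite, so is
`𝒦_{E,0}[p^∞]` (`localTowerKerPrimary κ E 0`), since restriction `H¹(Γ_E, ·) → H¹(H_{E,0}, ·)` is
a bijection (`bijective_resH1Hom_subgroupIncl`) compatible with the two restrictions to `H_{E,∞}`
(`resH1Hom_comp`). Greenberg, LNM 1716, §3 p. 86 (the maps `r_v` at `n = 0`); Serre, *Galois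
Cohomology*, I.§2.4. [cite: GreenbergLNM1716, §3 p. 86] -/
theorem finite_localTowerKerPrimary_zero_of_finite_primary_subgroupResKer
    (h : Finite {x : subgroupResKer (localPoints W E) (localSubgroup κ.kerSubgroup E) //
      ∃ k : ℕ, p ^ k • x = 0}) :
    Finite (W.localTowerKerPrimary κ E 0) := by
  let P : Type u := localPoints W E
  let H0 : Subgroup (Field.absoluteGaloisGroup E) := localSubgroup (κ.layerSubgroup 0) E
  let Hi : Subgroup (Field.absoluteGaloisGroup E) := localSubgroup κ.kerSubgroup E
  have hmem0 : ∀ σ : Field.absoluteGaloisGroup E, σ ∈ H0 := fun σ ↦ by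
    change σ ∈ localSubgroup (κ.layerSubgroup 0) E
    rw [mem_localSubgroup_iff, ZpExtension.layerSubgroup_zero]
    exact Subgroup.mem_top _
  have hle : Hi ≤ H0 := localSubgroup_ker_le_layer κ E 0
  -- the bijection `r : H¹(Γ_E, P) → H¹(H_{E,0}, P)`
  let r : discreteH1 (Field.absoluteGaloisGroup E) P →+ discreteH1 H0 P :=
    resH1Hom (Literature.NumberTheory.EllipticCurves.subgroupIncl H0) (AddMonoidHom.id P)
      (fun _ _ ↦ rfl)
  have hr : Function.Bijective r := bijective_resH1Hom_subgroupIncl P H0 hmem0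
  have hcomp : (Literature.NumberTheory.EllipticCurves.resOfLe P hle).comp r = resSubgroup Hi P := by
    unfold Literature.NumberTheory.EllipticCurves.resOfLe ResKernel.resSubgroup
    rw [resH1Hom_comp]
    exact resH1Hom_congr (ContinuousMonoidHom.ext fun _ ↦ rfl) (AddMonoidHom.ext fun _ ↦ rfl) _ _
  let e : discreteH1 (Field.absoluteGaloisGroup E) P ≃ discreteH1 H0 P := Equiv.ofBijective r hr
  have he : ∀ c, r (e.symm c) = c := fun c ↦ Equiv.ofBijective_apply_symm_apply r hr c
  -- the embedding
  let f : W.localTowerKerPrimary κ E 0 → {x : subgroupResKer P Hi // ∃ k : ℕ, p ^ k • x = 0} :=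
    fun c ↦ ⟨⟨e.symm (c : discreteH1 H0 P), by
        rw [ResKernel.mem_subgroupResKer_iff, ← hcomp, AddMonoidHom.comp_apply, he]
        exact (W.mem_localTowerKer_iff κ E 0 _).mp c.2.1⟩, by
        obtain ⟨k, hk⟩ := c.2.2
        refine ⟨k, Subtype.ext (hr.1 ?_)⟩
        change r (p ^ k • e.symm (c : discreteH1 H0 P)) = r 0
        rw [map_nsmul, he, hk, map_zero]⟩
  have hf : Function.Injective f := fun a b hab ↦ by
    have h1 := congrArg (fun z ↦ r ((z.1 : subgroupResKer P Hi) : discreteH1 _ P)) hab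
    have h2 : (a : discreteH1 H0 P) = b := by simpa only [f, he] using h1
    exact Subtype.ext h2
  exact Finite.of_injective f hf

end WeierstrassCurve
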